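import Mathlib
import HarnessLib

/-!
# Shelf 1574, line `sparse_sieve`: tools for the counting half of `EnstrophyQuarterLaw ⇒ UniformSparseness`

Helper file (`--supports stmt-NavierStokesRegularity-1574 --as helper`). Three elementary lemmas consumed by the
counting argument that turns the dissipation quantum (`…EnstrophyQuarterLawDissipationQuantum.small_of_cknE_le`)
and the window quarter law into a bound on the number of `4r`-separated `ε₀`-concentrating balls (stub S2
`UniformSparseness` of `Cruxes/EnstrophyQuarterLaw/Lines/sparse_sieve.lean` as a no-loss cut):

* `card_filter_mem_ball_le_of_separated` — VOLUME PACKING: an `s`-separated finite family in `ℝ³` has at most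
  `((ρ + s/2)/(s/2))³` members in any ball of radius `ρ` (the balls `B(x, s/2)` are disjoint and lie in
  `B(w, ρ + s/2)`; Lebesgue measure scales like `r³`);
* `sum_setLIntegral_ball_le_of_separated` — BOUNDED OVERLAP: for such a family and `g ≥ 0` a.e.-measurable,
  `Σ_{x ∈ F} ∫_{B(x, ρ)} g ≤ ((ρ + s/2)/(s/2))³ ∫ g`;
* `le_of_ae_le_of_continuousOn` — an a.e. upper bound on an open set for a function continuous there holds at
  EVERY point of the set (open sets have positive measure; closure argument), the step from the a.e. sup bound
  of ε-regularity to the classical slice.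

HONEST FRAMING: measure-theoretic bookkeeping only; nothing here bears on the regularity problem;
`EnstrophyQuarterLaw` (1574) and `UniformSparseness` stay OPEN. No summit statement is proved.
-/

noncomputable section

-- the summit-side namespace repeats a component by design (D-0017)
set_option linter.dupNamespace false

namespace Summit.NavierStokesRegularity.NavierStokesRegularity.Theorems.EnstrophyQuarterLaw.SparsenessTools

open Set MeasureTheory Metric Filter Topology
open scoped ENNReal NNReal

/-! ### Volume packing for separated families -/

open Classical in
/-- **Volume packing.** If the points of a finite family `F ⊆ ℝ³` are pairwise at distance `≥ s > 0`, then
for every `w` and `ρ > 0` at most `((ρ + s/2)/(s/2))³` of them lie in the ball `B(w, ρ)` — written for the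
filter `{x ∈ F | w ∈ B(x, ρ)}` (the balls `B(x, s/2)` are pairwise disjoint, measurable, contained in
`B(w, ρ + s/2)`, and `vol B(·, r) = r³ · vol B(0, 1)`). [folklore] -/
theorem card_filter_mem_ball_le_of_separated {s ρ : ℝ} (hs : 0 < s) (hρ : 0 < ρ)
    (F : Finset (EuclideanSpace ℝ (Fin 3)))
    (hsep : ∀ x ∈ F, ∀ y ∈ F, x ≠ y → s ≤ dist x y) (w : EuclideanSpace ℝ (Fin 3)) :
    ((F.filter (fun x => w ∈ ball x ρ)).card : ℝ) ≤ ((ρ + s / 2) / (s / 2)) ^ 3 := by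
  classical
  set F' := F.filter (fun x => w ∈ ball x ρ) with hF'
  have hs2 : 0 < s / 2 := by positivity
  -- the small balls are pairwise disjoint
  have hdisj : (F' : Set (EuclideanSpace ℝ (Fin 3))).PairwiseDisjoint (fun x => ball x (s / 2)) := by
    intro x hx y hy hxy
    have hx' : x ∈ F := (Finset.mem_filter.1 hx).1
    have hy' : y ∈ F := (Finset.mem_filter.1 hy).1
    refine ball_disjoint_ball ?_
    have := hsep x hx' y hy' hxy
    linarith
  -- and contained in the big ball
  have hsub : (⋃ x ∈ F', ball x (s / 2)) ⊆ ball w (ρ + s / 2) := by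
    intro y hy
    rw [mem_iUnion₂] at hy
    obtain ⟨x, hx, hyx⟩ := hy
    have hwx : w ∈ ball x ρ := (Finset.mem_filter.1 hx).2
    rw [mem_ball] at hyx hwx ⊢
    calc dist y w ≤ dist y x + dist x w := dist_triangle _ _ _
      _ < s / 2 + ρ := by rw [dist_comm x w]; exact add_lt_add hyx hwx
      _ = ρ + s / 2 := by ring
  -- measures
  have hfin : Module.finrank ℝ (EuclideanSpace ℝ (Fin 3)) = 3 := by simp
  have hvol : ∀ (x : EuclideanSpace ℝ (Fin 3)) (r : ℝ), 0 < r →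
      volume (ball x r) = ENNReal.ofReal (r ^ 3) * volume (ball (0 : EuclideanSpace ℝ (Fin 3)) 1) := by
    intro x r hr
    rw [Measure.addHaar_ball_of_pos volume x hr, hfin]
  have hV0 : volume (ball (0 : EuclideanSpace ℝ (Fin 3)) 1) ≠ 0 := (measure_ball_pos volume _ one_pos).ne'
  have hVtop : volume (ball (0 : EuclideanSpace ℝ (Fin 3)) 1) ≠ ⊤ := measure_ball_lt_top.ne
  have hmeas : volume (⋃ x ∈ F', ball x (s / 2)) = ∑ x ∈ F', volume (ball x (s / 2)) :=
    measure_biUnion_finset hdisj fun x _ => measurableSet_ball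
  have hsum : ∑ x ∈ F', volume (ball x (s / 2)) =
      (F'.card : ℝ≥0∞) * (ENNReal.ofReal ((s / 2) ^ 3) * volume (ball (0 : EuclideanSpace ℝ (Fin 3)) 1)) := by
    rw [Finset.sum_congr rfl fun x _ => hvol x (s / 2) hs2, Finset.sum_const, nsmul_eq_mul]
  have hle : (F'.card : ℝ≥0∞) * (ENNReal.ofReal ((s / 2) ^ 3) * volume (ball (0 : EuclideanSpace ℝ (Fin 3)) 1)) ≤
      ENNReal.ofReal ((ρ + s / 2) ^ 3) * volume (ball (0 : EuclideanSpace ℝ (Fin 3)) 1) := by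
    rw [← hsum, ← hmeas, ← hvol w (ρ + s / 2) (by positivity)]
    exact measure_mono hsub
  -- cancel the unit-ball volume and pass to the reals
  have hle' : (F'.card : ℝ≥0∞) * ENNReal.ofReal ((s / 2) ^ 3) ≤ ENNReal.ofReal ((ρ + s / 2) ^ 3) := by
    rw [← mul_assoc] at hle
    exact (ENNReal.mul_le_mul_iff_left hV0 hVtop).1 hle
  have hreal : (F'.card : ℝ) * (s / 2) ^ 3 ≤ (ρ + s / 2) ^ 3 := by
    have h1 := ENNReal.toReal_mono ENNReal.ofReal_ne_top hle'
    rw [ENNReal.toReal_mul, ENNReal.toReal_ofReal (by positivity),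
      ENNReal.toReal_ofReal (by positivity), ENNReal.toReal_natCast] at h1
    exact h1
  rw [div_pow, le_div_iff₀ (by positivity)]
  exact hreal

/-! ### Bounded overlap of integrals over the balls of a separated family -/

/-- **Bounded overlap.** For an `s`-separated finite family `F ⊆ ℝ³`, `ρ > 0` and an a.e.-measurable
`g : ℝ³ → [0, ∞]`: `Σ_{x ∈ F} ∫_{B(x, ρ)} g ≤ ((ρ + s/2)/(s/2))³ · ∫ g` (pointwise, the number of balls
`B(x, ρ)`, `x ∈ F`, containing a given point is at most the packing number). [folklore] -/
theorem sum_setLIntegral_ball_le_of_separated {s ρ : ℝ} (hs : 0 < s) (hρ : 0 < ρ)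
    (F : Finset (EuclideanSpace ℝ (Fin 3)))
    (hsep : ∀ x ∈ F, ∀ y ∈ F, x ≠ y → s ≤ dist x y) {g : EuclideanSpace ℝ (Fin 3) → ℝ≥0∞} (hg : AEMeasurable g) :
    ∑ x ∈ F, ∫⁻ y in ball x ρ, g y ≤
      ENNReal.ofReal (((ρ + s / 2) / (s / 2)) ^ 3) * ∫⁻ y, g y := by
  classical
  set M : ℝ := ((ρ + s / 2) / (s / 2)) ^ 3 with hM
  have hind : ∀ x ∈ F, ∫⁻ y in ball x ρ, g y = ∫⁻ y, (ball x ρ).indicator g y := fun x _ =>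
    (lintegral_indicator measurableSet_ball _).symm
  rw [Finset.sum_congr rfl hind, ← lintegral_finsetSum' _ fun x _ =>
    (hg.indicator measurableSet_ball), ← lintegral_const_mul' _ _ ENNReal.ofReal_ne_top]
  refine lintegral_mono fun y => ?_
  have hpt : ∑ x ∈ F, (ball x ρ).indicator g y =
      ((F.filter (fun x => y ∈ ball x ρ)).card : ℝ≥0∞) * g y := by
    simp only [Set.indicator_apply]
    rw [← Finset.sum_filter, Finset.sum_const, nsmul_eq_mul]
  rw [hpt]
  refine mul_le_mul' ?_ le_rfl
  have hc := card_filter_mem_ball_le_of_separated hs hρ F hsep y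
  calc ((F.filter (fun x => y ∈ ball x ρ)).card : ℝ≥0∞)
      = ENNReal.ofReal ((F.filter (fun x => y ∈ ball x ρ)).card : ℝ) := by
        rw [ENNReal.ofReal_natCast]
    _ ≤ ENNReal.ofReal M := ENNReal.ofReal_le_ofReal hc

/-! ### From an a.e. bound on an open set to every point, for continuous functions -/

/-- **A.e. bounds on open sets hold everywhere for continuous functions.** If `μ` charges open sets, `U`
is open, `f` is continuous on `U` and `f ≤ B` a.e. on `U`, then `f x ≤ B` for EVERY `x ∈ U` (the set where
the bound holds is dense, `Measure.dense_of_ae`; `x` lies in the closure of its trace on `U`, along which `f`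
tends to `f x`). [folklore] -/
theorem le_of_ae_le_of_continuousOn {X : Type*} [TopologicalSpace X] [MeasurableSpace X]
    [OpensMeasurableSpace X] {μ : Measure X} [μ.IsOpenPosMeasure] {U : Set X} (hU : IsOpen U) {f : X → ℝ}
    (hf : ContinuousOn f U) {B : ℝ} (h : ∀ᵐ x ∂(μ.restrict U), f x ≤ B) : ∀ x ∈ U, f x ≤ B := by
  rw [ae_restrict_iff' hU.measurableSet] at h
  have hd : Dense {x | x ∈ U → f x ≤ B} := Measure.dense_of_ae h
  intro x hx
  set S : Set X := {x | x ∈ U → f x ≤ B} with hS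
  have hcl : x ∈ closure (U ∩ S) :=
    hU.inter_closure ⟨hx, by rw [hd.closure_eq]; exact mem_univ _⟩
  haveI : (𝓝[U ∩ S] x).NeBot := mem_closure_iff_nhdsWithin_neBot.1 hcl
  have htend : Tendsto f (𝓝[U ∩ S] x) (𝓝 (f x)) := (hf x hx).mono inter_subset_left
  have hev : ∀ᶠ y in 𝓝[U ∩ S] x, f y ≤ B :=
    eventually_mem_nhdsWithin.mono fun y hy => hy.2 hy.1
  exact le_of_tendsto htend hev

end Summit.NavierStokesRegularity.NavierStokesRegularity.Theorems.EnstrophyQuarterLaw.SparsenessTools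

end
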